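import Summits.QuantumFields.GaugeBoot.DiagonalRPTorusTwoDegenerate
import HarnessLib

/-!
# Diagonal RP on the two-dimensional torus, gauge-invariant sector, I: untwisting the back layer
(gauge-boot, task L3(ε))

HONEST FRAMING (cell `pub-gaugeboot`, page 1 of every file): the venture produces certified bounds
on lattice expectations at stated coupling, gauge group, dimension and torus size; NOT a mass gap,
NOT a continuum limit, NOT a string tension; NOT Yang–Mills-summit-bearing (barriers
`FixedCouplingUltralocality`, `PerturbativeInvisibility`). This module is part of a small POSITIVE
structural result about which positivity constraints a two-dimensional TORUS certificate may use;
it discharges nothing else.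

Setting of `DiagonalRPTorusTwoGeometry.lean`: the square torus `(ℤ/L)²`, the diagonal coordinate
`k = y_i - y_j`, the back-layer value `c = L/2`, the swap `θ` (`siteDiagSwap`) and the induced
involution `Θ` of configurations (`configDiagSwap`). The swap FIXES the mirror layer `k = 0`
pointwise but acts on the back layer `k = c` as the translation `τ` by `c (e_i + e_j)`
(`siteDiagSwap_eq_tauSite`): the pairing of the closed half with its mirror image through the
back layer is twisted by `τ` (the mechanism behind `DiagonalRPTorusNegativeTwo.lean`). This file
introduces the relabelling that removes the twist:

* `tauSite`, `tauEdge` — the translation `τ` (an involution for even `L`, commuting with `θ`,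
  preserving `k`, the closed half and the set of links below);
* `TW i j e` — the link `e` TOUCHES THE BACK LAYER (one endpoint has `k = c`): in `d = 2` these
  are exactly the links between the layers `c - 1` / `c + 1` and `c`;
* `edgeTwist` — `θ` followed by `τ` on the links touching the back layer; an involution;
  `configTwistSwap` (`Θ'U = U ∘ edgeTwist`) and `configTau` (`T̂`, relabel the links touching the
  back layer by `τ`), with `Θ' = T̂ ∘ Θ` (`configTwistSwap_eq`); both preserve product Haar
  measure (`measurePreserving_configTwistSwap`, `measurePreserving_configTau`);
* the point of the construction: under `Θ'` BOTH crossing layers are untwisted —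
  `C_y(Θ'U) = D_y(U)` on the mirror `k = 0` and `D_y(Θ'U) = C_y(U)` on the back layer `k = c`
  (`cT_configTwistSwap_of_kd_eq_zero`, `dT_configTwistSwap_of_kd_eq_cc`), so the mirror and
  back plaquette couplings are Gram kernels between `U` and `Θ'U`
  (`DiagonalRPTorusTwoGram.lean`);
* `Θ'` maps the links of the closed half off the closed half (`not_inHalf_edgeTwist`).

All statements are elementary and proved. References for the mechanism: K. Osterwalder,
E. Seiler, Ann. Phys. 110 (1978) 440, §2 (the untwisted two-layer argument this reduces to).
-/

open MeasureTheory Complex Finset Function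
open scoped ComplexOrder ENNReal

namespace Summit.QuantumFields.GaugeBoot

open Literature.MathematicalPhysics.QuantumFieldTheory

noncomputable section

namespace DiagRPTwo

/-! ## The translation `τ` by `c (e_i + e_j)` -/

section Tau

variable {L : ℕ}

/-- `τ y = y + c (e_0 + e_1)`: every coordinate is shifted by `c = L/2`. -/
def tauSite (y : Site 2 L) : Site 2 L := fun k => y k + cc L

/-- `τ` on links: translate the base point. -/
def tauEdge (e : Edge 2 L) : Edge 2 L := (tauSite e.1, e.2)

/-- `c + c = 0` for even `L`. -/
theorem cc_add_cc (hL : Even L) : cc L + cc L = 0 := by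
  have h := neg_cc (L := L) hL
  rw [neg_eq_iff_add_eq_zero] at h
  exact h

/-- `τ` preserves the diagonal coordinate. -/
@[simp] theorem kd_tauSite (i j : Fin 2) (y : Site 2 L) : kd i j (tauSite y) = kd i j y := by
  simp only [kd, tauSite]
  ring

/-- `τ` is an involution (even `L`). -/
theorem tauSite_tauSite (hL : Even L) (y : Site 2 L) : tauSite (tauSite y) = y := by
  funext k
  simp only [tauSite, add_assoc, cc_add_cc hL, add_zero]

/-- `τ` commutes with the lattice steps. -/
theorem tauSite_shift (y : Site 2 L) (μ : Fin 2) : tauSite (y.shift μ) = (tauSite y).shift μ := by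
  funext k
  simp only [tauSite, Site.shift, Pi.add_apply]
  ring

/-- `τ` commutes with the swap. -/
theorem siteDiagSwap_tauSite (i j : Fin 2) (y : Site 2 L) :
    siteDiagSwap i j (tauSite y) = tauSite (siteDiagSwap i j y) := by
  funext k
  simp only [siteDiagSwap, tauSite]

/-- A site of the mirror `k = 0` is fixed by the swap. -/
theorem siteDiagSwap_eq_self_of_kd_eq_zero {i j : Fin 2} (hij : i ≠ j) {y : Site 2 L}
    (hy : kd i j y = 0) : siteDiagSwap i j y = y := by
  have h : y i = y j := sub_eq_zero.1 hy
  funext k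
  rcases ((by decide : ∀ a b c : Fin 2, a ≠ b → c = a ∨ c = b) i j k hij) with rfl | rfl
  · simp only [siteDiagSwap, Equiv.swap_apply_left, h]
  · simp only [siteDiagSwap, Equiv.swap_apply_right, h]

/-- **The swap acts on the back layer `k = c` as the translation `τ`.** -/
theorem siteDiagSwap_eq_tauSite (hL : Even L) {i j : Fin 2} (hij : i ≠ j) {y : Site 2 L}
    (hy : kd i j y = cc L) : siteDiagSwap i j y = tauSite y := by
  have h1 : y i = y j + cc L := by rw [← hy, kd]; abel
  have h2 : y j = y i + cc L := by
    rw [h1, add_assoc, cc_add_cc hL, add_zero]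
  funext k
  rcases ((by decide : ∀ a b c : Fin 2, a ≠ b → c = a ∨ c = b) i j k hij) with rfl | rfl
  · simp only [siteDiagSwap, Equiv.swap_apply_left, tauSite]
    exact h2
  · simp only [siteDiagSwap, Equiv.swap_apply_right, tauSite]
    exact h1

/-- `τ` is an involution on links. -/
theorem tauEdge_tauEdge (hL : Even L) (e : Edge 2 L) : tauEdge (tauEdge e) = e := by
  obtain ⟨y, μ⟩ := e
  simp only [tauEdge, tauSite_tauSite hL]

/-- `τ` commutes with the swap of links. -/
theorem edgeDiagSwap_tauEdge (i j : Fin 2) (e : Edge 2 L) :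
    edgeDiagSwap i j (tauEdge e) = tauEdge (edgeDiagSwap i j e) := by
  obtain ⟨y, μ⟩ := e
  simp only [edgeDiagSwap, tauEdge, siteDiagSwap_tauSite]

/-- `τ` preserves the closed half. -/
theorem inHalf_tauEdge_iff {i j : Fin 2} (e : Edge 2 L) : InHalf i j (tauEdge e) ↔ InHalf i j e := by
  obtain ⟨y, μ⟩ := e
  simp only [InHalf, tauEdge, ← tauSite_shift, kd_tauSite]

end Tau

/-! ## Links touching the back layer, and the twisted swap of links -/

section Twist

variable {L : ℕ}

/-- The link `e` touches the back layer: one of its endpoints has `k = c`. [shape] A parametric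
definition of a proposition — NOT a fact. [folklore] -/
def TW (i j : Fin 2) (e : Edge 2 L) : Prop := kd i j e.1 = cc L ∨ kd i j (e.1.shift e.2) = cc L

/-- `TW` is decidable. -/
instance decTW (i j : Fin 2) : DecidablePred (TW (L := L) i j) := fun e => by
  unfold TW; infer_instance

/-- `τ` preserves the set of links touching the back layer. -/
theorem tw_tauEdge_iff {i j : Fin 2} (e : Edge 2 L) : TW i j (tauEdge e) ↔ TW i j e := by
  obtain ⟨y, μ⟩ := e
  simp only [TW, tauEdge, ← tauSite_shift, kd_tauSite]

/-- The swap preserves the set of links touching the back layer (even `L`). -/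
theorem tw_edgeDiagSwap_iff (hL : Even L) {i j : Fin 2} (e : Edge 2 L) :
    TW i j (edgeDiagSwap i j e) ↔ TW i j e := by
  obtain ⟨y, μ⟩ := e
  have key : ∀ z : Site 2 L, kd i j (siteDiagSwap i j z) = cc L ↔ kd i j z = cc L := fun z => by
    rw [kd_siteDiagSwap, neg_eq_iff_eq_neg, neg_cc hL]
  simp only [TW, edgeDiagSwap, ← siteDiagSwap_shift, key]

/-- The twisted swap of links: `θ`, followed by `τ` on the links touching the back layer. -/
def edgeTwist (i j : Fin 2) (e : Edge 2 L) : Edge 2 L :=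
  if TW i j e then tauEdge (edgeDiagSwap i j e) else edgeDiagSwap i j e

/-- The relabelling of the links touching the back layer by `τ`. -/
def edgeTau (i j : Fin 2) (e : Edge 2 L) : Edge 2 L := if TW i j e then tauEdge e else e

/-- The twisted swap on a link touching the back layer. -/
theorem edgeTwist_of_tw {i j : Fin 2} {e : Edge 2 L} (he : TW i j e) :
    edgeTwist i j e = tauEdge (edgeDiagSwap i j e) := if_pos he

/-- The twisted swap on a link not touching the back layer. -/
theorem edgeTwist_of_not_tw {i j : Fin 2} {e : Edge 2 L} (he : ¬TW i j e) :
    edgeTwist i j e = edgeDiagSwap i j e := if_neg he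

/-- The twisted swap is an involution (even `L`). -/
theorem edgeTwist_edgeTwist (hL : Even L) (i j : Fin 2) (e : Edge 2 L) :
    edgeTwist i j (edgeTwist i j e) = e := by
  by_cases he : TW i j e
  · have he' : TW i j (tauEdge (edgeDiagSwap i j e)) := by
      rwa [tw_tauEdge_iff, tw_edgeDiagSwap_iff hL]
    rw [edgeTwist_of_tw he, edgeTwist_of_tw he', edgeDiagSwap_tauEdge, tauEdge_tauEdge hL,
      edgeDiagSwap_edgeDiagSwap]
  · have he' : ¬TW i j (edgeDiagSwap i j e) := by rwa [tw_edgeDiagSwap_iff hL]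
    rw [edgeTwist_of_not_tw he, edgeTwist_of_not_tw he', edgeDiagSwap_edgeDiagSwap]

/-- `edgeTau` is an involution (even `L`). -/
theorem edgeTau_edgeTau (hL : Even L) (i j : Fin 2) (e : Edge 2 L) :
    edgeTau i j (edgeTau i j e) = e := by
  by_cases he : TW i j e
  · have he' : TW i j (tauEdge e) := by rwa [tw_tauEdge_iff]
    simp only [edgeTau, if_pos he, if_pos he', tauEdge_tauEdge hL]
  · simp only [edgeTau, if_neg he]

/-- `edgeTwist = edgeDiagSwap ∘ edgeTau`... in the order used below: `θ'(e) = θ(edgeTau e)`. -/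
theorem edgeTwist_eq (i j : Fin 2) (e : Edge 2 L) :
    edgeTwist i j e = edgeDiagSwap i j (edgeTau i j e) := by
  by_cases he : TW i j e
  · rw [edgeTwist_of_tw he, edgeTau, if_pos he, edgeDiagSwap_tauEdge]
  · rw [edgeTwist_of_not_tw he, edgeTau, if_neg he]

/-- The twisted swap carries the links of the closed half OFF the closed half (`L ≥ 4`). -/
theorem not_inHalf_edgeTwist [NeZero L] (hL : Even L) (h4 : 4 ≤ L) {i j : Fin 2} (hij : i ≠ j)
    {e : Edge 2 L} (he : InHalf i j e) : ¬InHalf i j (edgeTwist i j e) := by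
  by_cases ht : TW i j e
  · rw [edgeTwist_of_tw ht, inHalf_tauEdge_iff]
    exact not_inHalf_edgeDiagSwap hL h4 hij he
  · rw [edgeTwist_of_not_tw ht]
    exact not_inHalf_edgeDiagSwap hL h4 hij he

end Twist

/-! ## The twisted swap and the back-layer relabelling of configurations -/

section Config

variable {L : ℕ} {G : Type*}

/-- `Θ' U = U ∘ edgeTwist`: the twisted swap of configurations. -/
def configTwistSwap (i j : Fin 2) (U : GaugeConfig 2 L G) : GaugeConfig 2 L G :=
  fun e => U (edgeTwist i j e)

/-- `T̂ U = U ∘ edgeTau`: relabel the links touching the back layer by `τ`. -/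
def configTau (i j : Fin 2) (U : GaugeConfig 2 L G) : GaugeConfig 2 L G :=
  fun e => U (edgeTau i j e)

/-- `Θ' = T̂ ∘ Θ`. -/
theorem configTwistSwap_eq (i j : Fin 2) (U : GaugeConfig 2 L G) :
    configTwistSwap i j U = configTau i j (configDiagSwap i j U) := by
  funext e
  simp only [configTwistSwap, configTau, configDiagSwap, edgeTwist_eq]

/-- `T̂` is an involution (even `L`). -/
theorem configTau_configTau (hL : Even L) (i j : Fin 2) (U : GaugeConfig 2 L G) :
    configTau i j (configTau i j U) = U := by
  funext e
  simp only [configTau, edgeTau_edgeTau hL]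

/-- `T̂` does not touch the links off the back layer. -/
theorem configTau_apply_of_not_tw {i j : Fin 2} (U : GaugeConfig 2 L G) {e : Edge 2 L}
    (he : ¬TW i j e) : configTau i j U e = U e := by
  simp only [configTau, edgeTau, if_neg he]

/-- `T̂` on a link touching the back layer. -/
theorem configTau_apply_of_tw {i j : Fin 2} (U : GaugeConfig 2 L G) {e : Edge 2 L}
    (he : TW i j e) : configTau i j U e = U (tauEdge e) := by
  simp only [configTau, edgeTau, if_pos he]

variable [Group G]

/-- **Mirror layer untwisted**: `C_y(Θ'U) = D_y(U)` for `k(y) = 0` (`L ≥ 4`). -/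
theorem cT_configTwistSwap_of_kd_eq_zero (h4 : 4 ≤ L) {i j : Fin 2} (hij : i ≠ j)
    (U : GaugeConfig 2 L G) {y : Site 2 L} (hy : kd i j y = 0) :
    cT i j (configTwistSwap i j U) y = dT i j U y := by
  have hθy : siteDiagSwap i j y = y := siteDiagSwap_eq_self_of_kd_eq_zero hij hy
  have h1 : ¬TW i j (y, i) := by
    rintro (h | h)
    · exact cc_ne_zero h4 (h.symm.trans hy)
    · rw [kd_shift_left hij, hy, zero_add] at h
      exact cc_ne_one h4 h.symm
  have h2 : ¬TW i j (y.shift i, j) := by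
    rintro (h | h)
    · rw [kd_shift_left hij, hy, zero_add] at h
      exact cc_ne_one h4 h.symm
    · rw [kd_shift_right hij, kd_shift_left hij, hy] at h
      exact cc_ne_zero h4 (by rw [← h]; ring)
  simp only [cT, dT, configTwistSwap, edgeTwist_of_not_tw h1, edgeTwist_of_not_tw h2, edgeDiagSwap,
    siteDiagSwap_shift, hθy, Equiv.swap_apply_left, Equiv.swap_apply_right]

/-- **Back layer untwisted**: `D_y(Θ'U) = C_y(U)` for `k(y) = c` (even `L`). -/
theorem dT_configTwistSwap_of_kd_eq_cc (hL : Even L) {i j : Fin 2} (hij : i ≠ j)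
    (U : GaugeConfig 2 L G) {y : Site 2 L} (hy : kd i j y = cc L) :
    dT i j (configTwistSwap i j U) y = cT i j U y := by
  have hθy : siteDiagSwap i j y = tauSite y := siteDiagSwap_eq_tauSite hL hij hy
  have h1 : TW i j (y, j) := Or.inl hy
  have h2 : TW i j (y.shift j, i) := by
    right
    show kd i j ((y.shift j).shift i) = cc L
    rw [kd_shift_left hij, kd_shift_right hij, hy]; ring
  simp only [cT, dT, configTwistSwap, edgeTwist_of_tw h1, edgeTwist_of_tw h2, edgeDiagSwap,
    siteDiagSwap_shift, hθy, Equiv.swap_apply_left, Equiv.swap_apply_right, tauEdge,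
    ← tauSite_shift, tauSite_tauSite hL]

end Config

/-! ## Measure preservation of the relabellings -/

section Relabel

variable {L : ℕ} [NeZero L] {G : Type*} [MeasurableSpace G]

omit [NeZero L] in
/-- Relabelling the links by an involution `σ` is the measurable equivalence `piCongrLeft` of the
permutation `σ`. -/
theorem coe_piCongrLeft_involutive {σ : Edge 2 L → Edge 2 L} (hσ : Function.Involutive σ) :
    ⇑(MeasurableEquiv.piCongrLeft (fun _ : Edge 2 L => G) (hσ.toPerm σ)) =
      fun (U : GaugeConfig 2 L G) e => U (σ e) := by
  funext U e
  rw [MeasurableEquiv.coe_piCongrLeft]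
  have h1 := Equiv.piCongrLeft_apply_apply (P := fun _ : Edge 2 L => G) (e := hσ.toPerm σ)
    U ((hσ.toPerm σ).symm e)
  rw [Equiv.apply_symm_apply] at h1
  rw [h1]
  rfl

/-- Relabelling the links by an involution preserves every product of copies of one σ-finite
measure. -/
theorem measurePreserving_comp_involutive {σ : Edge 2 L → Edge 2 L} (hσ : Function.Involutive σ)
    (μ₀ : Measure G) [SigmaFinite μ₀] :
    MeasurePreserving (fun (U : GaugeConfig 2 L G) e => U (σ e)) (Measure.pi fun _ => μ₀)
      (Measure.pi fun _ => μ₀) := by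
  have h := MeasureTheory.measurePreserving_piCongrLeft (fun _ : Edge 2 L => μ₀) (hσ.toPerm σ)
  rwa [coe_piCongrLeft_involutive hσ] at h

end Relabel

section Measure

variable {L : ℕ} [NeZero L] {G : Type*} [Group G] [TopologicalSpace G] [IsTopologicalGroup G]
  [CompactSpace G] [MeasurableSpace G] [BorelSpace G]

/-- `Θ'` preserves product Haar measure. -/
theorem measurePreserving_configTwistSwap (hL : Even L) (i j : Fin 2) :
    MeasurePreserving (configTwistSwap (G := G) (L := L) i j) (linkMeasure L G) (linkMeasure L G) :=
  measurePreserving_comp_involutive (edgeTwist_edgeTwist hL i j) _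

/-- `T̂` preserves product Haar measure. -/
theorem measurePreserving_configTau (hL : Even L) (i j : Fin 2) :
    MeasurePreserving (configTau (G := G) (L := L) i j) (linkMeasure L G) (linkMeasure L G) :=
  measurePreserving_comp_involutive (edgeTau_edgeTau hL i j) _

omit [Group G] [TopologicalSpace G] [IsTopologicalGroup G] [CompactSpace G] [MeasurableSpace G]
  [BorelSpace G] in
/-- The coordinates of `Θ'U` on the closed half read `U` off the closed half (`L ≥ 4`). -/
theorem dependsOn_configTwistSwap_apply (hL : Even L) (h4 : 4 ≤ L) {i j : Fin 2} (hij : i ≠ j)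
    {e : Edge 2 L} (he : e ∈ halfLinks (L := L) i j) :
    DependsOn (fun U : GaugeConfig 2 L G => configTwistSwap i j U e)
      (((halfLinks (L := L) i j)ᶜ : Finset (Edge 2 L)) : Set (Edge 2 L)) := by
  intro U V hUV
  refine hUV (edgeTwist i j e) (Finset.mem_coe.2 (Finset.mem_compl.2 fun h => ?_))
  exact not_inHalf_edgeTwist hL h4 hij (mem_halfLinks.1 he) (mem_halfLinks.1 h)

end Measure

/-! ## The links of the crossing transports lie in the closed half -/

section HalfLinks

variable {L : ℕ}

/-- The two links of `C_y` for `y` on the mirror are links of the closed half (`L ≥ 4`). -/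
theorem inHalf_cT_links (h4 : 4 ≤ L) {i j : Fin 2} (hij : i ≠ j) {y : Site 2 L}
    (hy : kd i j y = 0) : InHalf i j (y, i) ∧ InHalf i j (y.shift i, j) := by
  have hv : (kd i j y).val = 0 := by rw [hy, ZMod.val_zero]
  have hv1 : (kd i j (y.shift i)).val = 1 := by
    rw [kd_shift_left hij, hy, zero_add, val_one_of_four_le h4]
  have hv2 : kd i j ((y.shift i).shift j) = kd i j y := by
    rw [kd_shift_right hij, kd_shift_left hij]; ring
  refine ⟨⟨by simp only [hv]; omega, by simp only [hv1]; omega⟩,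
    ⟨by simp only [hv1]; omega, by simp only [hv2, hv]; omega⟩⟩

end HalfLinks

end DiagRPTwo

end

end Summit.QuantumFields.GaugeBoot
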